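import Mathlib.Combinatorics.SetFamily.LYM
import Mathlib.Analysis.SpecialFunctions.Pow.Real
import Summits.CriticalPhenomena.SAWScalingLimit.Theorems.CriticalBubbleBound.Negative.CriticalBubbleBoundBoundaryBulkMemoryless
import HarnessLib

/-!
# Line `kesten-product-renewal-dictionary` for the crux `SAWTotalPositivity.CriticalBubbleBound`
(stmt-CriticalPhenomena-7117): the Erdős–Littlewood–Offord sign-pattern bound (stub D)

The combinatorial core of the anti-concentration estimate `P(Y₁ + ⋯ + Y_m = y) ≤ C m^{-1/2}` for
the transversal coordinate of Kesten's renewal walk (Madras–Slade 1993, Lemma 8.1.3), done without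
Fourier analysis, by the Erdős (1945) proof of the Littlewood–Offord lemma: for integers `a_k`
(`k < m`) and a target `y`, the number of sign patterns `ε ∈ {±1}^m` with `Σ_k ε_k a_k = y` is at
most `2^{m-K} · C(K, ⌊K/2⌋) ≤ √2 · 2^m / √(K+1)`, where `K = #{k : a_k ≠ 0}`.

Proof: restrict to the support `S = {k : a_k ≠ 0}`; on a level set of the signed sum the set of
indices carrying the sign `+|a_k|` determines the pattern on `S`, and two such sets are never
strictly nested (the half-sum `Σ_{+} |a_k|` is constant on the level set and `|a_k| ≥ 1` on `S`),
so by Sperner's theorem (`IsAntichain.sperner`) each fibre of the restriction to the complement of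
`S` has at most `C(K, ⌊K/2⌋)` elements; finally `C(K, ⌊K/2⌋)² (K+1) ≤ 2 · 4^K` from the tree's
`C(2n,n)² (n+1) ≤ 16ⁿ` (`Negative.centralBinom_sq_mul_succ_le`).

Source: N. Madras, G. Slade, *The Self-Avoiding Walk*, Birkhäuser (1993), §8.1 (Lemma 8.1.3);
P. Erdős, *On a lemma of Littlewood and Offord*, Bull. Amer. Math. Soc. 51 (1945), 898–902.
-/

noncomputable section

open Summit.CriticalPhenomena.SAWScalingLimit.Theorems.CriticalBubbleBound.Negative
open scoped ENNReal NNReal BigOperators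
open Classical

namespace Summit.CriticalPhenomena.SAWScalingLimit.Theorems.CriticalBubbleBound.Kesten.MS

/-! ## Pointwise sign bookkeeping -/

/-- For a sign `b` and an integer `x`: `(±x) + |x|` is `2|x|` exactly when the signed term is
`+|x|`, i.e. when `b = [0 < x]`, and `0` otherwise (both sides vanish for `x = 0`). [folklore] -/
theorem lo_signedTerm_add_abs (b : Bool) (x : ℤ) :
    (if b then x else -x) + |x| = 2 * (if b = decide (0 < x) then |x| else 0) := by
  rcases lt_trichotomy x 0 with hx | rfl | hx
  · have hd : decide (0 < x) = false := decide_eq_false (not_lt.mpr hx.le)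
    rw [hd, abs_of_neg hx]
    cases b <;> simp
    omega
  · simp
  · have hd : decide (0 < x) = true := decide_eq_true hx
    rw [hd, abs_of_pos hx]
    cases b <;> simp
    omega

/-- Summing `lo_signedTerm_add_abs`: the signed sum plus `Σ |a_k|` is twice the sum of `|a_k|`
over the indices whose signed term is `+|a_k|`. [folklore] -/
theorem lo_sum_signed_add_sum_abs {m : ℕ} (a : Fin m → ℤ) (ε : Fin m → Bool) :
    (∑ k, (if ε k then a k else -a k)) + ∑ k, |a k| =
      2 * ∑ k ∈ Finset.univ.filter (fun k => ε k = decide (0 < a k)), |a k| := by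
  rw [Finset.sum_filter, Finset.mul_sum, ← Finset.sum_add_distrib]
  exact Finset.sum_congr rfl (fun k _ => lo_signedTerm_add_abs (ε k) (a k))

/-- Two Booleans that agree on whether they equal a third one are equal. [folklore] -/
theorem lo_bool_eq_of_iff_eq {b₁ b₂ d : Bool} (h : b₁ = d ↔ b₂ = d) : b₁ = b₂ := by
  revert b₁ b₂ d
  decide

/-! ## The Erdős–Sperner count -/

/-- **Erdős–Littlewood–Offord count.** If `S` is the support of `a : Fin m → ℤ` and every sign
pattern in `L` has signed sum `y`, then `#L ≤ 2^{m - #S} · C(#S, ⌊#S/2⌋)`: the patterns in `L`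
with a fixed set of `+|a_k|`-indices on `S` are determined by their restriction to the complement
of `S`, and these index sets form an antichain in `Finset S` (Sperner). [folklore] -/
theorem lo_card_le_choose {m : ℕ} (a : Fin m → ℤ) (y : ℤ) (S : Finset (Fin m))
    (hS : ∀ k, k ∈ S ↔ a k ≠ 0) (L : Finset (Fin m → Bool))
    (hL : ∀ ε ∈ L, (∑ k, (if ε k then a k else -a k)) = y) :
    L.card ≤ 2 ^ (m - S.card) * S.card.choose (S.card / 2) := by
  have hZ : Fintype.card {k : Fin m // k ∉ S} = m - S.card := by
    rw [Fintype.card_subtype_compl, Fintype.card_coe, Fintype.card_fin]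
  -- the set of support indices whose signed term is `+|a k|`
  let φ : (Fin m → Bool) → Finset S :=
    fun ε => Finset.univ.filter (fun k => ε k.1 = decide (0 < a k.1))
  have hφmem : ∀ ε (k : S), k ∈ φ ε ↔ ε k.1 = decide (0 < a k.1) := by
    intro ε k
    simp [φ]
  have hφsum : ∀ ε, ∑ k ∈ φ ε, |a k.1| =
      ∑ k ∈ Finset.univ.filter (fun k => ε k = decide (0 < a k)), |a k| := by
    intro ε
    calc ∑ k ∈ φ ε, |a k.1|
        = ∑ k : S, (if ε k.1 = decide (0 < a k.1) then |a k.1| else 0) :=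
          Finset.sum_filter _ _
      _ = ∑ k ∈ S, (if ε k = decide (0 < a k) then |a k| else 0) :=
          Finset.sum_coe_sort S (fun k => if ε k = decide (0 < a k) then |a k| else 0)
      _ = ∑ k ∈ Finset.univ.filter (fun k => k ∈ S),
            (if ε k = decide (0 < a k) then |a k| else 0) := by
          congr 1
          ext k
          simp
      _ = ∑ k, (if ε k = decide (0 < a k) then |a k| else 0) := by
          refine Finset.sum_filter_of_ne (fun k _ hk => ?_)
          rw [hS]
          intro h0
          apply hk
          simp [h0]
      _ = ∑ k ∈ Finset.univ.filter (fun k => ε k = decide (0 < a k)), |a k| :=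
          (Finset.sum_filter _ _).symm
  have hkey : ∀ ε ∈ L, 2 * ∑ k ∈ φ ε, |a k.1| = y + ∑ k, |a k| := by
    intro ε hε
    rw [hφsum ε, ← lo_sum_signed_add_sum_abs a ε, hL ε hε]
  -- Step 1: fibres of `φ` on `L` inject into the sign patterns on the complement of `S`.
  have h1 : L.card ≤ 2 ^ (m - S.card) * (L.image φ).card := by
    refine Finset.card_le_mul_card_image L _ (fun A _ => ?_)
    calc (L.filter (fun ε => φ ε = A)).card
        ≤ (Finset.univ : Finset ({k : Fin m // k ∉ S} → Bool)).card := by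
          refine Finset.card_le_card_of_injOn (fun ε k => ε k.1)
            (fun ε _ => Finset.mem_coe.2 (Finset.mem_univ _)) ?_
          intro ε₁ h₁ ε₂ h₂ heq
          have e₁ : φ ε₁ = A := (Finset.mem_filter.1 (Finset.mem_coe.1 h₁)).2
          have e₂ : φ ε₂ = A := (Finset.mem_filter.1 (Finset.mem_coe.1 h₂)).2
          funext k
          by_cases hk : k ∈ S
          · have hiff : (⟨k, hk⟩ : S) ∈ φ ε₁ ↔ (⟨k, hk⟩ : S) ∈ φ ε₂ := by rw [e₁, e₂]
            rw [hφmem, hφmem] at hiff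
            exact lo_bool_eq_of_iff_eq hiff
          · exact congrFun heq ⟨k, hk⟩
      _ = 2 ^ (m - S.card) := by
          rw [Finset.card_univ, Fintype.card_fun, Fintype.card_bool, hZ]
  -- Step 2: the image is an antichain in `Finset S`, hence Sperner.
  have h2 : (L.image φ).card ≤ S.card.choose (S.card / 2) := by
    have hanti : IsAntichain (· ≤ ·) ((L.image φ : Finset (Finset S)) : Set (Finset S)) := by
      refine isAntichain_iff_forall_not_lt.mpr ?_
      intro A hA B hB hlt
      obtain ⟨ε₁, hε₁, rfl⟩ := Finset.mem_image.1 (Finset.mem_coe.1 hA)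
      obtain ⟨ε₂, hε₂, rfl⟩ := Finset.mem_image.1 (Finset.mem_coe.1 hB)
      obtain ⟨i, hi₂, hi₁⟩ := Finset.exists_of_ssubset hlt
      have hpos : 0 < |a i.1| := abs_pos.mpr ((hS i.1).mp i.2)
      have hsum : ∑ k ∈ φ ε₁, |a k.1| < ∑ k ∈ φ ε₂, |a k.1| :=
        Finset.sum_lt_sum_of_subset hlt.le hi₂ hi₁ hpos (fun j _ _ => abs_nonneg _)
      have k₁ := hkey ε₁ hε₁
      have k₂ := hkey ε₂ hε₂
      omega
    have h := hanti.sperner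
    rwa [Fintype.card_coe] at h
  calc L.card ≤ 2 ^ (m - S.card) * (L.image φ).card := h1
    _ ≤ 2 ^ (m - S.card) * S.card.choose (S.card / 2) := Nat.mul_le_mul_left _ h2

/-! ## The central binomial coefficient -/

/-- `C(K, ⌊K/2⌋)² (K+1) ≤ 2 · 4^K` for every `K` (both parities, from
`C(2n,n)² (n+1) ≤ 16ⁿ`). [folklore] -/
theorem lo_choose_half_sq_mul_succ_le (K : ℕ) :
    (K.choose (K / 2)) ^ 2 * (K + 1) ≤ 2 * 4 ^ K := by
  obtain ⟨n, rfl | rfl⟩ := Nat.even_or_odd' K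
  · -- even `K = 2n`
    have h := centralBinom_sq_mul_succ_le n
    have h4 : (4 : ℕ) ^ (2 * n) = 16 ^ n := by
      rw [pow_mul]
      norm_num
    rw [show 2 * n / 2 = n by omega, ← Nat.centralBinom_eq_two_mul_choose, h4]
    calc n.centralBinom ^ 2 * (2 * n + 1)
        ≤ n.centralBinom ^ 2 * (2 * (n + 1)) := Nat.mul_le_mul_left _ (by omega)
      _ = 2 * (n.centralBinom ^ 2 * (n + 1)) := by ring
      _ ≤ 2 * 16 ^ n := Nat.mul_le_mul_left _ h
  · -- odd `K = 2n + 1`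
    have h := centralBinom_sq_mul_succ_le (n + 1)
    have hcb : (n + 1).centralBinom = 2 * (2 * n + 1).choose n := by
      rw [Nat.centralBinom_eq_two_mul_choose, show 2 * (n + 1) = (2 * n + 1) + 1 by ring,
        Nat.choose_succ_succ', Nat.choose_symm_half]
      ring
    have h4 : (4 : ℕ) ^ (2 * n + 1) = 4 * 16 ^ n := by
      rw [pow_succ, pow_mul]
      norm_num [mul_comm]
    have h16 : (16 : ℕ) ^ (n + 1) = 16 * 16 ^ n := by ring
    rw [show (2 * n + 1) / 2 = n by omega, h4]
    rw [hcb, h16] at h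
    -- `h : (2c)² (n+2) ≤ 16 · 16ⁿ`; goal `c² (2n+2) ≤ 8 · 16ⁿ`
    nlinarith [h, Nat.zero_le (((2 * n + 1).choose n) ^ 2)]

/-- `C(K, ⌊K/2⌋) ≤ √2 · 2^K / √(K+1)` as real numbers. [folklore] -/
theorem lo_choose_half_le_real (K : ℕ) :
    ((K.choose (K / 2) : ℕ) : ℝ) ≤ Real.sqrt 2 * 2 ^ K / Real.sqrt (K + 1) := by
  have h := lo_choose_half_sq_mul_succ_le K
  have hpos : (0 : ℝ) < Real.sqrt (K + 1) := Real.sqrt_pos.mpr (by positivity)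
  rw [le_div_iff₀ hpos]
  calc ((K.choose (K / 2) : ℕ) : ℝ) * Real.sqrt (K + 1)
      = Real.sqrt ((((K.choose (K / 2) : ℕ) : ℝ)) ^ 2 * (K + 1)) := by
        rw [Real.sqrt_mul (sq_nonneg _), Real.sqrt_sq (Nat.cast_nonneg _)]
    _ ≤ Real.sqrt (2 * 4 ^ K) := Real.sqrt_le_sqrt (by exact_mod_cast h)
    _ = Real.sqrt 2 * 2 ^ K := by
        rw [Real.sqrt_mul (by norm_num : (0 : ℝ) ≤ 2),
          show (4 : ℝ) ^ K = (2 ^ K) ^ 2 by rw [sq, ← mul_pow]; norm_num,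
          Real.sqrt_sq (by positivity)]

/-- Real-number assembly: `#L ≤ 2^{m-K} C(K, ⌊K/2⌋)` and `K ≤ m` give
`#L ≤ √2 · 2^m / √(K+1)`. [folklore] -/
theorem lo_real_bound {L K m : ℕ} (hKm : K ≤ m) (hL : L ≤ 2 ^ (m - K) * K.choose (K / 2)) :
    (L : ℝ) ≤ Real.sqrt 2 * 2 ^ m / Real.sqrt (K + 1) := by
  have hc := lo_choose_half_le_real K
  calc (L : ℝ) ≤ (2 : ℝ) ^ (m - K) * ((K.choose (K / 2) : ℕ) : ℝ) := by exact_mod_cast hL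
    _ ≤ 2 ^ (m - K) * (Real.sqrt 2 * 2 ^ K / Real.sqrt (K + 1)) :=
        mul_le_mul_of_nonneg_left hc (by positivity)
    _ = Real.sqrt 2 * (2 ^ (m - K) * 2 ^ K) / Real.sqrt (K + 1) := by ring
    _ = Real.sqrt 2 * 2 ^ m / Real.sqrt (K + 1) := by rw [← pow_add, Nat.sub_add_cancel hKm]

/-! ## The stub -/

/-- **Erdős–Littlewood–Offord bound for sign patterns** (the combinatorial core of the
anti-concentration estimate for the transversal coordinate of Kesten's renewal walk,
Madras–Slade Lemma 8.1.3; Erdős 1945): for integers `a_k` (`k < m`) and a target `y`, the number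
of `ε ∈ {±1}^m` with `Σ_k ε_k a_k = y` is at most `√2 · 2^m / √(K+1)`, `K = #{k : a_k ≠ 0}`
(level sets restricted to the support are antichains — Sperner — and
`C(K, ⌊K/2⌋) ≤ √2 · 2^K / √(K+1)`). [cite: MadrasSlade1993, Lemma 8.1.3] -/
theorem ms_littlewoodOfford : ∀ (m : ℕ) (a : Fin m → ℤ) (y : ℤ), (((Finset.univ : Finset (Fin m → Bool)).filter (fun ε => (∑ k, (if ε k then a k else -a k)) = y)).card : ℝ) ≤ Real.sqrt 2 * 2 ^ m / Real.sqrt (((Finset.univ : Finset (Fin m)).filter (fun k => a k ≠ 0)).card + 1) := by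
  intro m a y
  exact lo_real_bound ((Finset.card_filter_le _ _).trans (by simp))
    (lo_card_le_choose a y _ (fun k => by simp) _ (fun ε hε => (Finset.mem_filter.mp hε).2))

end Summit.CriticalPhenomena.SAWScalingLimit.Theorems.CriticalBubbleBound.Kesten.MS

end
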